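/-
Copyright: lit-balaban cell (HOME `run/shared/lean/pub/lit-balaban/`), Phase-2 proof seat p12 (gen 7).  The proofs reproduce the
printed arguments; nothing is claimed beyond what the kernel checks below.
-/
import Mathlib.Algebra.Module.Equiv.Basic
import Mathlib.LinearAlgebra.Pi
import Mathlib.Algebra.BigOperators.Fin
import Mathlib.Data.Real.Basic

/-!
# `DybalskiStottmeisterTanimoto2024.DST24KernelLemma` — [DybalskiStottmeisterTanimoto2024] **§3.2 Lemma (kernel-lemma)** PROVED:
# the kernel of the block row `R = (R₁, …, R_m)` of invertible maps is the range of the bidiagonal block matrix `D`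

statement-level skeleton of published theorems with citation tags; proofs where landed; nothing here is a claim about
the Yang–Mills mass gap

W. Dybalski, A. Stottmeister, Y. Tanimoto, *The Bałaban variational problem in the non-linear sigma model*, Rev. Math. Phys.
**36** (2024), arXiv:2403.09800; source held `paper:arxiv-2403.09800` (§3.2 = tex chunks p0008–p0009).  Unit `lit-balaban-p12`
(gen 7).  This file is the abstract linear algebra behind the description of the tangent space of the constraint manifold
(`DST24TangentSpace`): it does not mention the lattice.

WHAT IS PRINTED (§3.2, Lemma (kernel-lemma)) AND PROVED HERE.  «Suppose `R_i`, `i = 1, …, m` are invertible transformations on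
`ℝ³`.  Let `R := (R₁, …, R_m)` be a transformation from `ℝ^{3m}` to `ℝ³`.  Define mappings `D_i = (0, …, R̄_i, −R̄_{i+1}, 0, …, 0)ᵀ`,
`i = 1, …, m − 1`, from `ℝ³` to `ℝ^{3m}`, where `R̄_i` denotes the inverse of `R_i`.  Then the kernel of `R` equals the range of
`D := (D₁, …, D_{m−1})`.»  Equivalently (the matrix `[D]` displayed before the lemma, rows `(R̄(x₁), 0, …)`, `(−R̄(x₂), R̄(x₂), 0, …)`,
…, `(0, …, −R̄(x_{L²}))`): `(Dw)_j = R̄_j (w_j − w_{j−1})` with the conventions `w₀ = w_m = 0`.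
* `rowR R v = Σ_j R_j v_j` — the block row `R`;  `Dmat R w` — the block matrix `D` applied to the bond variables
  `w = (w₁, …, w_{m−1})` (sites are `Fin (m+1)`, bonds `Fin m`, bond `i` joins sites `i.castSucc`, `i.succ`);
* `rowR_Dmat : rowR R (Dmat R w) = 0` («`RD = 0`») and `kernel_lemma : rowR R v = 0 ↔ ∃ w, Dmat R w = v` (kernel = range).
The print argues by a dimension count (`dim ker R ≤ 3(m−1)`, `RD = 0`, the ranges of the `D_i` are independent); here the
preimage is written down directly — `w_i := Σ_{j≤i} R_j v_j` (partial sums), for which `R̄_j(w_j − w_{j−1}) = R̄_j R_j v_j = v_j` and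
`w_m = Rv = 0` — a shorter road to the same statement over any module (generality costs nothing).
-/

namespace Literature.MathematicalPhysics.QuantumFieldTheory.DybalskiStottmeisterTanimoto2024.DST24KernelLemma

open scoped BigOperators

variable {M : Type*} [AddCommGroup M] {m : ℕ}

/-- Bond variable on the bond leaving site `j` towards `j+1` (`0` at the last site): `w_j` with `w_m := 0`.
[cite: DybalskiStottmeisterTanimoto2024, §3.2 display (D) before Lemma (kernel-lemma)] -/
def wOut (w : Fin m → M) (j : Fin (m + 1)) : M := if h : j = Fin.last m then 0 else w (j.castPred h)

/-- Bond variable on the bond entering site `j` from `j−1` (`0` at site `0`): `w_{j−1}` with `w₀ := 0`.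
[cite: DybalskiStottmeisterTanimoto2024, §3.2 display (D) before Lemma (kernel-lemma)] -/
def wIn (w : Fin m → M) (j : Fin (m + 1)) : M := if h : j = 0 then 0 else w (j.pred h)

/-- `w_m = 0` (no bond leaves the last site). [cite: DybalskiStottmeisterTanimoto2024, §3.2 Lemma (kernel-lemma), (D)] -/
@[simp] theorem wOut_last (w : Fin m → M) : wOut w (Fin.last m) = 0 := by simp [wOut]

/-- The bond leaving site `i` (not the last) carries `w_i`. [cite: DybalskiStottmeisterTanimoto2024, §3.2 Lemma (kernel-lemma), (D)] -/
@[simp] theorem wOut_castSucc (w : Fin m → M) (i : Fin m) : wOut w i.castSucc = w i := by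
  simp [wOut, Fin.castSucc_ne_last]

/-- `w₀ = 0` (no bond enters site `0`). [cite: DybalskiStottmeisterTanimoto2024, §3.2 Lemma (kernel-lemma), (D)] -/
@[simp] theorem wIn_zero (w : Fin m → M) : wIn w 0 = 0 := by simp [wIn]

/-- The bond entering site `i+1` carries `w_i`. [cite: DybalskiStottmeisterTanimoto2024, §3.2 Lemma (kernel-lemma), (D)] -/
@[simp] theorem wIn_succ (w : Fin m → M) (i : Fin m) : wIn w i.succ = w i := by
  simp [wIn, Fin.succ_ne_zero]

/-- `Σ_j w_j` over sites of the outgoing bond variables is `Σ_i w_i` (telescoping, proof of «`RD = 0`»). [cite: DybalskiStottmeisterTanimoto2024, §3.2 Lemma (kernel-lemma), proof] -/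
theorem sum_wOut (w : Fin m → M) : ∑ j, wOut w j = ∑ i, w i := by
  rw [Fin.sum_univ_castSucc, wOut_last, add_zero]
  exact Finset.sum_congr rfl fun i _ => wOut_castSucc w i

/-- `Σ_j w_{j−1}` over sites of the incoming bond variables is `Σ_i w_i` (telescoping, proof of «`RD = 0`»). [cite: DybalskiStottmeisterTanimoto2024, §3.2 Lemma (kernel-lemma), proof] -/
theorem sum_wIn (w : Fin m → M) : ∑ j, wIn w j = ∑ i, w i := by
  rw [Fin.sum_univ_succ, wIn_zero, zero_add]
  exact Finset.sum_congr rfl fun i _ => wIn_succ w i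

variable [Module ℝ M]

/-- The block row `R := (R₁, …, R_m) : ℝ^{3m} → ℝ³`, `(v_j)_j ↦ Σ_j R_j v_j` (sites indexed by `Fin (m+1)`).
[cite: DybalskiStottmeisterTanimoto2024, §3.2 Lemma (kernel-lemma) («Let `R := (R₁,…,R_m)` be a transformation from `ℝ^{3m}` to `ℝ³`»)] -/
def rowR (R : Fin (m + 1) → M ≃ₗ[ℝ] M) (v : Fin (m + 1) → M) : M := ∑ j, R j (v j)

/-- The block matrix `D = (D₁, …, D_{m−1})`, `D_i = (0, …, R̄_i, −R̄_{i+1}, 0, …)ᵀ`, applied to `w`: `(Dw)_j = R̄_j (w_j − w_{j−1})`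
(rows of the displayed matrix `[D]`), `R̄_j = R_j⁻¹`. [cite: DybalskiStottmeisterTanimoto2024, §3.2 Lemma (kernel-lemma), (D)] -/
def Dmat (R : Fin (m + 1) → M ≃ₗ[ℝ] M) (w : Fin m → M) : Fin (m + 1) → M :=
  fun j => (R j).symm (wOut w j - wIn w j)

/-- `Rv = Σ_j R_j v_j`. [cite: DybalskiStottmeisterTanimoto2024, §3.2 Lemma (kernel-lemma) («`R := (R₁, …, R_m)`»)] -/
theorem rowR_apply (R : Fin (m + 1) → M ≃ₗ[ℝ] M) (v : Fin (m + 1) → M) : rowR R v = ∑ j, R j (v j) := rfl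

/-- `(Dw)_j = R̄_j (w_j − w_{j−1})`. [cite: DybalskiStottmeisterTanimoto2024, §3.2 Lemma (kernel-lemma), (D)] -/
theorem Dmat_apply (R : Fin (m + 1) → M ≃ₗ[ℝ] M) (w : Fin m → M) (j : Fin (m + 1)) :
    Dmat R w j = (R j).symm (wOut w j - wIn w j) := rfl

/-- The column `D_i u` («there is a three-dimensional space of vectors … `(0, …, R̄(c₋)v⃗, −R̄(c₊)v⃗, 0, …)`»): `D` of the bond
variable supported on the single bond `i`. [cite: DybalskiStottmeisterTanimoto2024, §3.2 (constraint-tangent-vectors), Lemma (kernel-lemma)] -/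
theorem Dmat_single (R : Fin (m + 1) → M ≃ₗ[ℝ] M) (i : Fin m) (u : M) (j : Fin (m + 1)) :
    Dmat R (Pi.single i u) j =
      (if j = i.castSucc then (R j).symm u else 0) - (if j = i.succ then (R j).symm u else 0) := by
  rw [Dmat_apply, map_sub]
  congr 1
  · by_cases h : j = Fin.last m
    · subst h
      rw [wOut_last, map_zero, if_neg (Fin.castSucc_lt_last i).ne']
    · obtain ⟨j', rfl⟩ : ∃ j' : Fin m, j'.castSucc = j := ⟨j.castPred h, Fin.castSucc_castPred j h⟩
      rw [wOut_castSucc, Pi.single_apply]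
      simp only [Fin.castSucc_inj]
      split_ifs <;> simp
  · by_cases h : j = 0
    · subst h
      rw [wIn_zero, map_zero, if_neg (Fin.succ_ne_zero i).symm]
    · obtain ⟨j', rfl⟩ : ∃ j' : Fin m, j'.succ = j := ⟨j.pred h, Fin.succ_pred j h⟩
      rw [wIn_succ, Pi.single_apply]
      simp only [Fin.succ_inj]
      split_ifs <;> simp

/-- «`RD = 0`»: every `Dw` lies in the kernel of `R` (the sum telescopes).
[cite: DybalskiStottmeisterTanimoto2024, §3.2 Lemma (kernel-lemma), proof («one notes that `RD = 0`»)] -/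
theorem rowR_Dmat (R : Fin (m + 1) → M ≃ₗ[ℝ] M) (w : Fin m → M) : rowR R (Dmat R w) = 0 := by
  simp only [rowR_apply, Dmat_apply, LinearEquiv.apply_symm_apply, Finset.sum_sub_distrib, sum_wOut, sum_wIn, sub_self]

/-- Partial sums `S_k := Σ_{j<k} R_j v_j` (the parametrisation «`−v⃗₁ = R̄₁R₂v⃗₂ + ⋯ + R̄₁R_m v⃗_m`» of the print, solved forward).
[cite: DybalskiStottmeisterTanimoto2024, §3.2 Lemma (kernel-lemma), proof] -/
def partialSum (R : Fin (m + 1) → M ≃ₗ[ℝ] M) (v : Fin (m + 1) → M) (k : ℕ) : M :=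
  ∑ j : Fin (m + 1), if (j : ℕ) < k then R j (v j) else 0

/-- `S₀ = 0`. [cite: DybalskiStottmeisterTanimoto2024, §3.2 Lemma (kernel-lemma), proof] -/
theorem partialSum_zero (R : Fin (m + 1) → M ≃ₗ[ℝ] M) (v : Fin (m + 1) → M) : partialSum R v 0 = 0 := by
  simp [partialSum]

/-- `S_{k+1} = S_k + R_k v_k`. [cite: DybalskiStottmeisterTanimoto2024, §3.2 Lemma (kernel-lemma), proof] -/
theorem partialSum_succ (R : Fin (m + 1) → M ≃ₗ[ℝ] M) (v : Fin (m + 1) → M) (k : Fin (m + 1)) :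
    partialSum R v ((k : ℕ) + 1) = partialSum R v k + R k (v k) := by
  unfold partialSum
  have : ∀ j : Fin (m + 1), (if (j : ℕ) < (k : ℕ) + 1 then R j (v j) else 0) =
      (if (j : ℕ) < (k : ℕ) then R j (v j) else 0) + (if j = k then R j (v j) else 0) := by
    intro j
    by_cases hjk : j = k
    · subst hjk; simp
    · have hne : (j : ℕ) ≠ k := fun h => hjk (Fin.ext h)
      by_cases hlt : (j : ℕ) < k
      · rw [if_pos (Nat.lt_succ_of_lt hlt), if_pos hlt, if_neg hjk, add_zero]
      · have : ¬ (j : ℕ) < (k : ℕ) + 1 := fun h => hne (by omega)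
        rw [if_neg this, if_neg hlt, if_neg hjk, add_zero]
  rw [Finset.sum_congr rfl fun j _ => this j, Finset.sum_add_distrib, Finset.sum_ite_eq' Finset.univ k,
    if_pos (Finset.mem_univ _)]

/-- `S_{m+1} = Rv`. [cite: DybalskiStottmeisterTanimoto2024, §3.2 Lemma (kernel-lemma), proof] -/
theorem partialSum_top (R : Fin (m + 1) → M ≃ₗ[ℝ] M) (v : Fin (m + 1) → M) : partialSum R v (m + 1) = rowR R v := by
  unfold partialSum rowR
  exact Finset.sum_congr rfl fun j _ => if_pos j.isLt

/-- **Lemma (kernel-lemma).** «Then the kernel of `R` equals the range of `D := (D₁, …, D_{m−1})`.»  The preimage of a kernel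
vector `v` is `w_i = Σ_{j≤i} R_j v_j`. [cite: DybalskiStottmeisterTanimoto2024, §3.2 Lemma (kernel-lemma)] -/
theorem kernel_lemma (R : Fin (m + 1) → M ≃ₗ[ℝ] M) (v : Fin (m + 1) → M) :
    rowR R v = 0 ↔ ∃ w : Fin m → M, Dmat R w = v := by
  constructor
  · intro hv
    refine ⟨fun i => partialSum R v ((i : ℕ) + 1), funext fun j => ?_⟩
    have hOut : wOut (fun i : Fin m => partialSum R v ((i : ℕ) + 1)) j = partialSum R v ((j : ℕ) + 1) := by
      by_cases h : j = Fin.last m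
      · subst h
        rw [wOut_last, Fin.val_last, partialSum_top, hv]
      · obtain ⟨j', rfl⟩ : ∃ j' : Fin m, j'.castSucc = j := ⟨j.castPred h, Fin.castSucc_castPred j h⟩
        rw [wOut_castSucc, Fin.val_castSucc]
    have hIn : wIn (fun i : Fin m => partialSum R v ((i : ℕ) + 1)) j = partialSum R v j := by
      by_cases h : j = 0
      · subst h
        rw [wIn_zero, Fin.val_zero, partialSum_zero]
      · obtain ⟨j', rfl⟩ : ∃ j' : Fin m, j'.succ = j := ⟨j.pred h, Fin.succ_pred j h⟩
        rw [wIn_succ, Fin.val_succ]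
    rw [Dmat_apply, hOut, hIn, partialSum_succ, add_sub_cancel_left, LinearEquiv.symm_apply_apply]
  · rintro ⟨w, rfl⟩
    exact rowR_Dmat R w

/-- The kernel as a set is the range of `D`. [cite: DybalskiStottmeisterTanimoto2024, §3.2 Lemma (kernel-lemma)] -/
theorem ker_eq_range (R : Fin (m + 1) → M ≃ₗ[ℝ] M) : {v | rowR R v = 0} = Set.range (Dmat R) :=
  Set.ext fun v => kernel_lemma R v

/-- «Thus we can parametrize this kernel with `3(m−1)` parameters»: `D` is injective (the parametrisation is faithful), since
`w_k = Σ_{j≤k} R_j (Dw)_j`. [cite: DybalskiStottmeisterTanimoto2024, §3.2 Lemma (kernel-lemma), proof] -/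
theorem Dmat_injective (R : Fin (m + 1) → M ≃ₗ[ℝ] M) : Function.Injective (Dmat R) := by
  -- we recover `w` from `Dw` by partial sums: `w_k = Σ_{j ≤ k} R_j (Dw)_j`, by induction on `k`
  have key : ∀ (w : Fin m → M) (k : ℕ) (hk : k < m), w ⟨k, hk⟩ = partialSum R (Dmat R w) (k + 1) := by
    intro w k
    induction k with
    | zero =>
      intro hk
      have h0 : ((Fin.castSucc (⟨0, hk⟩ : Fin m) : Fin (m + 1)) : ℕ) = 0 := rfl
      have hs := partialSum_succ R (Dmat R w) (Fin.castSucc ⟨0, hk⟩)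
      rw [h0] at hs
      rw [hs, partialSum_zero, zero_add, Dmat_apply, LinearEquiv.apply_symm_apply, wOut_castSucc,
        show (Fin.castSucc (⟨0, hk⟩ : Fin m) : Fin (m + 1)) = 0 from Fin.ext (by simp), wIn_zero, sub_zero]
    | succ k ih =>
      intro hk
      have hk' : k < m := Nat.lt_of_succ_lt hk
      have h1 : ((Fin.castSucc (⟨k + 1, hk⟩ : Fin m) : Fin (m + 1)) : ℕ) = k + 1 := rfl
      have hs := partialSum_succ R (Dmat R w) (Fin.castSucc ⟨k + 1, hk⟩)
      rw [h1] at hs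
      rw [hs, ← ih hk', Dmat_apply, LinearEquiv.apply_symm_apply, wOut_castSucc,
        show (Fin.castSucc (⟨k + 1, hk⟩ : Fin m) : Fin (m + 1)) = (⟨k, hk'⟩ : Fin m).succ from Fin.ext rfl, wIn_succ,
        add_sub_cancel]
  intro w w' h
  funext i
  rw [show i = ⟨(i : ℕ), i.isLt⟩ from rfl, key w i i.isLt, key w' i i.isLt, h]

end Literature.MathematicalPhysics.QuantumFieldTheory.DybalskiStottmeisterTanimoto2024.DST24KernelLemma
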